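import Summits.BirchSwinnertonDyer.BirchSwinnertonDyer.Theorems.KimAtThreeDeepLowerExpStarOmegaPlace
import Summits.BirchSwinnertonDyer.BirchSwinnertonDyer.Theorems.KimAtThreeDeepUpperExpStarTransport
import Literature.NumberTheory.PAdicHodge.DualExpElliptic
import Literature.NumberTheory.EllipticCurves.TateModuleFinite
import HarnessLib

/-!
# The `exp*`-side clauses of the W2 deep leaf FROM THE CITE FACTS: `hinj`/`hex` (Kato Prop. 1.2.3),
# `hker` ((S5a), Bloch–Kato) and `hdual` ((S5b), Tate duality) for the DEFINED `exp*_ω`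
# (route `KimAtThreeKolyvagin`, rung W2, cruxes 19075 / 19076 / 19560; cell `bsd-addord`, seat w2-c3 gen 8)

HONEST FRAMING. Theorems only (no definition, no named fact, no `sorry`; the tree's structures on `ℚ_v`
are switched on as LOCAL instances exactly as in `KimAtThreeDeepLowerExpStarOmegaPlace`, plus a local
re-prioritisation of the tree's `ℚ`-algebra structure `Place.instAlgebraCompletion`); nothing is closed
or booked; BSD is not proved by any of this. CONDITIONAL on four Literature cite facts (displayed
hypotheses, `Literature/NumberTheory/PAdicHodge/DualExpElliptic.lean`, p504202):
`cupLogInjective_and_hasDualExp_of_isDeRham` [Kato LNM 1553 II Prop. 1.2.3],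
`isDeRham_restrictedRationalTateRep` [Kato II Ex. 1.3.5 / Fontaine 1982],
`expStarCoord_eq_zero_iff_kummer` (S5a) [BK90 Lemma 3.8.1, Prop. 3.8, Ex. 3.11; Delbourgo 2008 Ex. 2.5],
`exists_smul_range_expStarCoord_iff_trace_log` (S5b) [Kato II Thm. 1.4.1 (4); BK90 Prop. 3.8 / Ex. 3.11].

For `W/ℚ` (elliptic, globally minimal), a prime `p`, a place `v ∋ p` and ANY local Néron line
`d : LocalNeronLineAt W p v` (w2-c2's `KimAtThreeDeepLowerExpStarOmegaPlace`):
* `hinj_hex_of_facts` — the two Prop-1.2.3 binders `hinj` / `hex` of `expStarOmegaPadicAt` for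
  `V_pW|_{Γ_{ℚ_v}}` (the Literature `restrictedRationalTateRep W ℚ_v p` IS `localRationalTateRep W p
  (galRestrictPlace v)`, `rfl`; finiteness of `V_pW` by `module_finite_rationalTateModule_holds`);
* `hker_of_facts` — **the clause `hker` VERBATIM**: `expStarOmegaPadicAt d hinj hex ι y = 0 ↔ ∀ j,
  tateLocalMap W p j (inr v) y ∈ W.kummerSelmerStructure (p^j·p) (inr v)` (for every `d`, `ι`; from (S5a)
  with `ψ := pushCocycle`, `tateLocalMap_oneCocycleClass`, `kummerSelmerStructure_apply`);
* `hdual_of_facts` — **the clause `hdual` VERBATIM** in `ℚ_p`-currency: `∃ e ≠ 0, ∃ ι : ℚ_v →+* ℚ_p,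
  ∀ a, (∃ y, expStarOmegaPadicAt (d.smul e he) hinj hex ι y = a) ↔ ∀ Q ∈ E(ℚ_p),
  ‖a · padicLog (W ⊗ ℚ_p) Q‖ ≤ 1` (from (S5b) at `F = ℚ_v` with the valuation `‖padicEquiv ·‖`, read in
  `ℚ_p` through `ι := padicEquiv v` by the transport file `KimAtThreeDeepUpperExpStarTransport`:
  `Tr_{ℚ_v/ℚ_p} = ι`, `ι ∘ log_{ℚ_v} = log_{ℚ_p} ∘ ι_*`, `padicLog = padicLogPointFiniteExt`, points along `ι_*`);
* `expStar_clauses_of_facts` — the three packaged as the `exp*`-side of w2-c2's (C1_ω)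
  (`KimAtThreeDeepLowerExpStarOmegaBridge`, hypothesis `hω`): for every `d` there are `hinj hex ιp e he`
  with `hker` and `hdual` for `φ := expStarOmegaPadicAt (d.smul e he) hinj hex ιp`. The remaining clauses
  of (C1_ω) (`κK ≠ 0`, X1-int_b, `ZetaBody`) are Kato's Euler system (Kato-v2 + (DEF)/(RES)/(LAT), other
  hands); with them, (C1_ω) — hence all five deep decls of W2 BY NAME (p502949, p496891) — follows from
  cite-only facts.

References: [Kato1993LNM1553] Ch. II Prop. 1.2.3, §1.2.4, Ex. 1.3.5, Thm. 1.4.1; [BlochKato1990] §3;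
[Delbourgo2008] §2.2; [SilvermanAEC2009] IV.6.4, VII.2.2.
-/

set_option autoImplicit false
-- the Theorems namespace of a single-conjunct summit repeats the summit name by design (D-0017)
set_option linter.dupNamespace false

noncomputable section

open scoped TensorProduct NumberField NNReal WithZero Classical
open Field ValuativeRel Function IsDedekindDomain NumberField
open Literature.NumberTheory.GaloisRepresentations
open Literature.NumberTheory.GaloisRepresentations.PeriodRingData
open Literature.NumberTheory.GaloisRepresentations.IsNonarchimedeanLocalField
open Literature.NumberTheory.PAdicHodge
open Literature.NumberTheory.EllipticCurves WeierstrassCurve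
open Literature.NumberTheory.EllipticCurves.FormalGroupChart
open Summit.BirchSwinnertonDyer.BirchSwinnertonDyer.Theorems.KimAtThreeDeepLowerExpStarOmega
open Summit.BirchSwinnertonDyer.BirchSwinnertonDyer.Theorems.KimAtThreeDeepLowerExpStarOmegaPlace
open Summit.BirchSwinnertonDyer.BirchSwinnertonDyer.Theorems.KimAtThreeDeepUpperExpStarTransport
open Summit.BirchSwinnertonDyer.Rank1Residual.GaloisImage
open Summit.BirchSwinnertonDyer.Rank1Residual.Additive (LocalLog.padicLog)
open Rat.HeightOneSpectrum

namespace Summit.BirchSwinnertonDyer.BirchSwinnertonDyer.Theorems.KimAtThreeDeepUpperExpStarFacts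

variable (W : WeierstrassCurve ℚ) [W.IsElliptic] (p : ℕ) [Fact p.Prime]
  (v : HeightOneSpectrum (𝓞 ℚ)) [hv : Fact (((p : ℕ) : 𝓞 ℚ) ∈ v.asIdeal)]

-- The tree's `ℚ`-algebra structure on `ℚ_v` (`Place.instAlgebraCompletion`) gets top priority LOCALLY, so that
-- class inference keeps choosing it — and not `DivisionRing.toRatAlgebra` — once `CharZero ℚ_v` is in scope
-- (w2-c2's GOTCHA in `KimAtThreeDeepLowerExpStarOmegaPlace`); this keeps
-- `restrictedTateRep W ℚ_v p = tateLocalRep W p (inr v)` definitional.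
attribute [local instance 100000] NumberField.Place.instAlgebraCompletion
attribute [local instance] valuativeRelPlace topologicalSpacePlace
attribute [local instance] isNonarchimedeanLocalField_place charZero_place
attribute [local instance] padicAlgebraPlace fact_not_isUnit_place isAdicComplete_place

/-- The Literature restricted Tate representation IS the cell's `tateLocalRep` (definitional). -/
example : restrictedTateRep W (Place.Completion (Sum.inr v : Place ℚ)) p = tateLocalRep W p (Sum.inr v) := rfl
example : restrictedRationalTateRep W (Place.Completion (Sum.inr v : Place ℚ)) p =
    localRationalTateRep W p (galRestrictPlace v) := rfl

/-- **`hinj` / `hex` at the place from Kato's Prop. 1.2.3 and `V_pE` de Rham** (the Literature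
`restrictedRationalTateRep W ℚ_v p` is `localRationalTateRep W p (galRestrictPlace v)` definitionally;
`V_pW` is finite-dimensional by `module_finite_rationalTateModule_holds`). [cite: Kato1993LNM1553, Ch. II Prop. 1.2.3 and Ex. 1.3.5] -/
theorem hinj_hex_of_facts (hP : cupLogInjective_and_hasDualExp_of_isDeRham)
    (hDR : isDeRham_restrictedRationalTateRep) :
    (bdRPeriodRingData (valuation_place_lt_one p v)).CupLogInjective (logCyclotomic p)
        (localRationalTateRep W p (galRestrictPlace v)) ∧
      ∀ z : contOneCocycles (localRationalTateRep W p (galRestrictPlace v)).toTopRep,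
        (bdRPeriodRingData (valuation_place_lt_one p v)).HasDualExp (logCyclotomic p)
          (localRationalTateRep W p (galRestrictPlace v)) fun σ => z.1 σ := by
  haveI : Module.Finite ℚ_[p] (W.rationalTateModule p) := WeierstrassCurve.module_finite_rationalTateModule_holds W p
  exact hP (valuation_place_lt_one p v) (restrictedRationalTateRep W _ p)
    (hDR W (valuation_place_lt_one p v))

/-- **`hker` VERBATIM at the place from (S5a)** (for every line datum and every `ι`): `ψ := pushCocycle`,
`tateLocalMap_oneCocycleClass`, `kummerSelmerStructure_apply`, and a continuous crossed homomorphism into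
`E[p^{k+1}]` is determined by its underlying points. [cite: BlochKato1990, Lemma 3.8.1, Prop. 3.8 and Example 3.11] -/
theorem hker_of_facts (hS : expStarCoord_eq_zero_iff_kummer) (d : LocalNeronLineAt W p v)
    (hinj : (bdRPeriodRingData (valuation_place_lt_one p v)).CupLogInjective (logCyclotomic p)
      (localRationalTateRep W p (galRestrictPlace v)))
    (hex : ∀ z : contOneCocycles (localRationalTateRep W p (galRestrictPlace v)).toTopRep,
      (bdRPeriodRingData (valuation_place_lt_one p v)).HasDualExp (logCyclotomic p)
        (localRationalTateRep W p (galRestrictPlace v)) fun σ => z.1 σ)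
    (ι : Place.Completion (Sum.inr v : Place ℚ) →+* ℚ_[p])
    (y : (tateLocalRep W p (Sum.inr v)).cohomology 1) :
    expStarOmegaPadicAt d hinj hex ι y = 0 ↔
      ∀ j : ℕ, tateLocalMap W p j (Sum.inr v) y ∈
        W.kummerSelmerStructure (((p : ℕ) : ℤ) ^ j * ((p : ℕ) : ℤ)) (Sum.inr v) := by
  obtain ⟨η, rfl⟩ := oneCocycleClass_surjective _ y
  rw [expStarOmegaPadicAt_eq_zero_iff, expStarOmegaAt_oneCocycleClass]
  have key := hS W (valuation_place_lt_one p v) d hinj hex η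
  change expStarCoord W (valuation_place_lt_one p v) d η = 0 ↔ _ at key
  -- LHS of `key` is the unfolded `expStarOmegaAt`
  refine key.trans ⟨fun h j => ?_, fun h k ψ hψ => ?_⟩
  · rw [tateLocalMap_oneCocycleClass, kummerSelmerStructure_apply]
    exact h j (pushCocycle W p j (Sum.inr v) η) fun g => rfl
  · have hj := h k
    rw [tateLocalMap_oneCocycleClass, kummerSelmerStructure_apply] at hj
    have hψ' : ψ = pushCocycle W p k (Sum.inr v) η := by
      apply Subtype.ext
      apply ContinuousMap.ext
      intro g
      exact Subtype.ext (hψ g)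
    rw [hψ']
    exact hj

/-- `exp*_ω` at the place on a class `[η]` IS the Literature `expStarCoord` of `η` (definitional).
[cite: Kato1993LNM1553, Ch. II §1.2.4] -/
theorem expStarOmegaAt_eq_expStarCoord (d : LocalNeronLineAt W p v)
    (η : contOneCocycles (tateLocalRep W p (Sum.inr v)).toTopRep) :
    expStarOmegaAt d (oneCocycleClass _ η) =
      expStarCoord W (valuation_place_lt_one p v) d η :=
  expStarOmegaAt_oneCocycleClass d η

/-- **`hdual` VERBATIM at the place from (S5b)**: for every local Néron line `d` there are a rescaling
`e • d` and the isomorphism `ι : ℚ_v → ℚ_p` (`padicEquiv`) for which the range of `exp*_{e•ω}` read in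
`ℚ_p` is the dual lattice `{a : ∀ Q ∈ E(ℚ_p), ‖a · log_ω Q‖ ≤ 1}` of the Summits logarithm `padicLog`.
Proof: (S5b) at `F = ℚ_v` with the valuation `‖padicEquiv ·‖` (compatible: same unit ball; `W ⊗ ℚ_v`
integral), then `Tr_{ℚ_v/ℚ_p} = padicEquiv`, the logarithm and the points transported along `padicEquiv`
(file `KimAtThreeDeepUpperExpStarTransport`). [cite: Kato1993LNM1553, Ch. II Thm. 1.4.1 (3)–(4)] [cite: BlochKato1990, Prop. 3.8 and Example 3.11] -/
theorem hdual_of_facts [W.IsGloballyMinimal] (hS : exists_smul_range_expStarCoord_iff_trace_log)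
    (d : LocalNeronLineAt W p v)
    (hinj : (bdRPeriodRingData (valuation_place_lt_one p v)).CupLogInjective (logCyclotomic p)
      (localRationalTateRep W p (galRestrictPlace v)))
    (hex : ∀ z : contOneCocycles (localRationalTateRep W p (galRestrictPlace v)).toTopRep,
      (bdRPeriodRingData (valuation_place_lt_one p v)).HasDualExp (logCyclotomic p)
        (localRationalTateRep W p (galRestrictPlace v)) fun σ => z.1 σ) :
    ∃ (e : Place.Completion (Sum.inr v : Place ℚ)) (he : e ≠ 0)
      (ι : Place.Completion (Sum.inr v : Place ℚ) →+* ℚ_[p]),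
      ∀ a : ℚ_[p], (∃ y, expStarOmegaPadicAt (d.smul e he) hinj hex ι y = a) ↔
        ∀ Q : (W.baseChange ℚ_[p]).toAffine.Point, ‖a * LocalLog.padicLog (W.baseChange ℚ_[p]) Q‖ ≤ 1 := by
  have hpv : ((p : ℕ) : 𝓞 ℚ) ∈ v.asIdeal := hv.out
  have hp' := primesEquiv_eq p v hpv
  subst hp'
  -- the isomorphism `ℚ_v ≃ ℚ_p` and the transported `p`-adic norm
  let eA0 : v.adicCompletion ℚ ≃ₐ[ℚ] ℚ_[((primesEquiv v : Nat.Primes) : ℕ)] :=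
    (adicCompletion.padicEquiv (R := 𝓞 ℚ) v).toAlgEquiv
  let eA : Place.Completion (Sum.inr v : Place ℚ) ≃ₐ[ℚ] ℚ_[((primesEquiv v : Nat.Primes) : ℕ)] := eA0
  have hcont : Continuous eA0.symm := (adicCompletion.padicEquiv (R := 𝓞 ℚ) v).symm.continuous
  let w' : Valuation (v.adicCompletion ℚ) ℝ≥0 :=
    (NormedField.valuation (K := ℚ_[((primesEquiv v : Nat.Primes) : ℕ)])).comap
      (eA0 : v.adicCompletion ℚ →+* _)
  let w : Valuation (Place.Completion (Sum.inr v : Place ℚ)) ℝ≥0 := w'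
  have hw : ∀ x, w' x = ‖eA0 x‖₊ := fun x => rfl
  haveI : w.Compatible := compatible_of_norm_algEquiv _ v eA0 w' hw (norm_padicEquiv_le_one_iff v)
  haveI hIv : (W.baseChange (v.adicCompletion ℚ)).IsIntegral w'.integer :=
    isIntegral_baseChange_of_norm_algEquiv eA0 hw W
  haveI : (W.baseChange (Place.Completion (Sum.inr v : Place ℚ))).IsIntegral w.integer := hIv
  obtain ⟨e, he, hrange⟩ := hS W (valuation_place_lt_one _ v) w d hinj hex
  refine ⟨e, he, (eA : Place.Completion (Sum.inr v : Place ℚ) →+* _), fun a => ?_⟩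
  have key := hrange (eA.symm a)
  -- LEFT: classes vs crossed homomorphisms, `ℚ_p` vs `ℚ_v` values
  have hL : (∃ y, expStarOmegaPadicAt (d.smul e he) hinj hex (eA : Place.Completion (Sum.inr v : Place ℚ) →+* _) y = a) ↔
      ∃ η : contOneCocycles (restrictedTateRep W (Place.Completion (Sum.inr v : Place ℚ)) _).toTopRep,
        expStarCoord W (valuation_place_lt_one _ v) (d.smul e he) η = eA.symm a := by
    constructor
    · rintro ⟨y, hy⟩
      obtain ⟨η, rfl⟩ := oneCocycleClass_surjective _ y
      refine ⟨η, ?_⟩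
      rw [expStarOmegaPadicAt_apply, expStarOmegaAt_eq_expStarCoord] at hy
      rw [← hy]
      exact (eA.symm_apply_apply _).symm
    · rintro ⟨η, hη⟩
      refine ⟨oneCocycleClass _ η, ?_⟩
      rw [expStarOmegaPadicAt_apply, expStarOmegaAt_eq_expStarCoord, hη]
      exact eA.apply_symm_apply a
  -- RIGHT: trace = `eA`, points and logarithms transported along `eA`
  haveI := isIntegral_valuationInteger_of_isIntegral_padicInt
    (W.baseChange ℚ_[((primesEquiv v : Nat.Primes) : ℕ)])
  have hlog : ∀ P : (W.baseChange (Place.Completion (Sum.inr v : Place ℚ))).toAffine.Point,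
      eA (eA.symm a * FormalGroupChart.padicLogPointFiniteExt w
          (W.baseChange (Place.Completion (Sum.inr v : Place ℚ))) ((primesEquiv v : Nat.Primes) : ℕ) P) =
        a * LocalLog.padicLog (W.baseChange ℚ_[((primesEquiv v : Nat.Primes) : ℕ)])
          (WeierstrassCurve.Affine.Point.map (eA : Place.Completion (Sum.inr v : Place ℚ) →ₐ[ℚ] _) P) := by
    intro P
    rw [map_mul, AlgEquiv.apply_symm_apply, padicLog_eq_padicLogPointFiniteExt]
    congr 1
    exact (padicLogPointFiniteExt_map_algEquiv eA0 hw W P).symm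
  have htr : ∀ x : Place.Completion (Sum.inr v : Place ℚ),
      Algebra.trace ℚ_[((primesEquiv v : Nat.Primes) : ℕ)] (Place.Completion (Sum.inr v : Place ℚ)) x = eA x :=
    fun x => trace_eq _ v eA0 hpv hcont x
  have hR : (∀ P : (W.baseChange (Place.Completion (Sum.inr v : Place ℚ))).toAffine.Point,
      ‖Algebra.trace ℚ_[((primesEquiv v : Nat.Primes) : ℕ)] (Place.Completion (Sum.inr v : Place ℚ))
          (eA.symm a * FormalGroupChart.padicLogPointFiniteExt w
            (W.baseChange (Place.Completion (Sum.inr v : Place ℚ))) ((primesEquiv v : Nat.Primes) : ℕ) P)‖ ≤ 1) ↔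
      ∀ Q : (W.baseChange ℚ_[((primesEquiv v : Nat.Primes) : ℕ)]).toAffine.Point, ‖a * LocalLog.padicLog (W.baseChange ℚ_[((primesEquiv v : Nat.Primes) : ℕ)]) Q‖ ≤ 1 := by
    constructor
    · intro h Q
      obtain ⟨P, rfl⟩ := exists_map_algEquiv_eq eA0 W Q
      have hP := h P
      rwa [htr, hlog] at hP
    · intro h P
      rw [htr, hlog]
      exact h _
  exact hL.trans (key.trans hR)

/-- **The `exp*`-side of (C1_ω) from the four cite facts**: for every local Néron line `d` at a place
`v ∋ p` there are the Prop-1.2.3 binders, the isomorphism `ιp : ℚ_v → ℚ_p` and a rescaling `e • d` such that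
`φ := expStarOmegaPadicAt (d.smul e he) hinj hex ιp` satisfies `hker` and `hdual` VERBATIM (the first
clauses of the hypothesis `hω` of `KimAtThreeDeepLowerExpStarOmegaBridge`; the remaining ones are Kato's
Euler system). [cite: Kato1993LNM1553, Ch. II Prop. 1.2.3, §1.2.4 and Thm. 1.4.1] [cite: BlochKato1990, Prop. 3.8 and Example 3.11] -/
theorem expStar_clauses_of_facts [W.IsGloballyMinimal] (hP : cupLogInjective_and_hasDualExp_of_isDeRham)
    (hDR : isDeRham_restrictedRationalTateRep) (hS : expStarCoord_eq_zero_iff_kummer)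
    (hT : exists_smul_range_expStarCoord_iff_trace_log) (d : LocalNeronLineAt W p v) :
    ∃ (hinj : (bdRPeriodRingData (valuation_place_lt_one p v)).CupLogInjective (logCyclotomic p)
        (localRationalTateRep W p (galRestrictPlace v)))
      (hex : ∀ z : contOneCocycles (localRationalTateRep W p (galRestrictPlace v)).toTopRep,
        (bdRPeriodRingData (valuation_place_lt_one p v)).HasDualExp (logCyclotomic p)
          (localRationalTateRep W p (galRestrictPlace v)) fun σ => z.1 σ)
      (ιp : Place.Completion (Sum.inr v : Place ℚ) →+* ℚ_[p])
      (e : Place.Completion (Sum.inr v : Place ℚ)) (he : e ≠ 0),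
      (∀ y, expStarOmegaPadicAt (d.smul e he) hinj hex ιp y = 0 ↔
        ∀ j : ℕ, tateLocalMap W p j (Sum.inr v) y ∈
          W.kummerSelmerStructure (((p : ℕ) : ℤ) ^ j * ((p : ℕ) : ℤ)) (Sum.inr v)) ∧
      (∀ a : ℚ_[p], (∃ y, expStarOmegaPadicAt (d.smul e he) hinj hex ιp y = a) ↔
        ∀ Q : (W.baseChange ℚ_[p]).toAffine.Point, ‖a * LocalLog.padicLog (W.baseChange ℚ_[p]) Q‖ ≤ 1) := by
  obtain ⟨hinj, hex⟩ := hinj_hex_of_facts W p v hP hDR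
  obtain ⟨e, he, ι, hdual⟩ := hdual_of_facts W p v hT d hinj hex
  exact ⟨hinj, hex, ι, e, he, fun y => hker_of_facts W p v hS (d.smul e he) hinj hex ι y, hdual⟩

end Summit.BirchSwinnertonDyer.BirchSwinnertonDyer.Theorems.KimAtThreeDeepUpperExpStarFacts

end
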